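import Mathlib
import HarnessLib

/-!
# Lai–Yu 2020, Lemma 3.3 (first half): partial-fraction coefficients as Taylor coefficients and
their `d_n`-integrality — proofs

Topic `Literature/NumberTheory/Irrationality/LaiYu2020`. Companion ("Proofs") file for
L. Lai, P. Yu, *A note on the number of irrational odd zeta values*, Compositio Math. **156** (2020)
1699–1717 = arXiv:1911.08458 [LaiYu2020], §3 Lemma 3.3 (arithmetic lemma), whose proof begins
(arXiv text pp. 6–7):

> «For any `k ∈ {0,1,⋯,n}` and any `i ∈ {1,2,⋯,s}`, by comparing (3.2) with the partial fraction
> expansion of `R_n(t)`, and by viewing `t^{s+1}R_n(t−k) ∈ ℚ[[t]]` as a formal series, we have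
> `a_{i,k} = [t^{s+1−i}] (t^{s+1} R_n(t−k))
>   = C(n,k)^{s+1} [t^{s+1−i}] ( ∏ F̃_{b,a}(t−k) · ∏_{0≤j≤n, j≠k} (1 + t/(j−k))^{−s−1} )
>   = C(n,k)^{s+1} ∑_{ℓ-tuples} ∏ [t^{ℓ_{b,a}}] F̃_{b,a}(t−k) ∏_{j≠k} (−1)^{ℓ_j} C(s+ℓ_j, ℓ_j)/(j−k)^{ℓ_j}`
> … By Proposition 3.2 and the fact `d_n^{ℓ_j}/(j−k)^{ℓ_j} ∈ ℤ`, we derive that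
> `d_n^{s+1−i} a_{i,k} ∈ ℤ`.»

We PROVE this step for a general numerator (theorems only, no definitions, no named facts;
sorry-free), entirely inside `ℚ[X]` (the formal series `(1 + t/c)^{−1}` is replaced by its
truncation `V_c = ∑_{ℓ≤s} (−t/c)^ℓ`, which agrees with it modulo `t^{s+1}`):

* `eq_polynomial_identity` — from the partial-fraction identity
  `Φ(t)/∏_{j=0}^{n}(t+j)^{s+1} = ∑_{k'} ∑_{i=1}^{s+1} a_{i,k'}/(t+k')^i` (off the poles) to the
  polynomial identity `Φ(X−k) = κ_k A_k(X) P_k(X) + X^{s+1} E_k(X)` with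
  `A_k = ∑_i a_{i,k} X^{s+1−i}`, `P_k = ∏_{j≠k} (1 + X/(j−k))^{s+1}`, `κ_k = ∏_{j≠k} (j−k)^{s+1}`;
* `coeff_eq_of_trunc` — truncation algebra: `P_k · Inv_k ≡ 1 (mod X^{s+1})` for
  `Inv_k = ∏_{j≠k} V_{j−k}^{s+1}`, hence **`κ_k a_{i,k} = [X^{s+1−i}] (Φ(X−k) · Inv_k(X))`**
  (`partialFraction_coeff_eq`);
* `dInt_mul`, `dInt_prod`, `dInt_V` — `D`-integrality (`D^ℓ [X^ℓ] ∈ ℤ` for all `ℓ`) is stable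
  under products and holds for `V_c` when `c ∣ D`;
* `partialFraction_coeff_isInt` — **the arithmetic lemma**: if `Φ = n!^{s+1} Φ₀` with
  `D^ℓ [X^ℓ] Φ₀(X−k) ∈ ℤ` for all `ℓ` and `k ≤ n`, and `1, …, n ∣ D`, then
  `D^{s+1−i} a_{i,k} ∈ ℤ` (`n!^{s+1}/κ_k = (± C(n,k))^{s+1}`). For Lai–Yu, `Φ₀ = ∏ F̃_{b,a}` and the
  hypothesis is Proposition 3.2 (`ProgressionValuation.prop32`) with `D = d_n`.

## References

* [LaiYu2020] L. Lai, P. Yu, Compositio Math. 156 (2020) 1699–1717, §3 Lemma 3.3 (proof, first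
  half) and [FischlerSprangZudilin2019, §3 Lemma 2] which it adapts.
-/

noncomputable section

open Finset Polynomial

namespace Literature.NumberTheory.Irrationality.LaiYu2020

/-! ### `D`-integrality of coefficients -/

/-- A finite sum of integers (inside `ℚ`) is an integer. [folklore] -/
private theorem isInt_sum {α : Type*} (s : Finset α) (f : α → ℚ)
    (h : ∀ i ∈ s, ∃ z : ℤ, f i = z) : ∃ z : ℤ, ∑ i ∈ s, f i = z := by
  classical
  induction s using Finset.induction_on with
  | empty => exact ⟨0, by simp⟩
  | insert a s ha ih =>
    obtain ⟨z₁, hz₁⟩ := h a (mem_insert_self a s)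
    obtain ⟨z₂, hz₂⟩ := ih fun i hi => h i (mem_insert_of_mem hi)
    exact ⟨z₁ + z₂, by rw [sum_insert ha, hz₁, hz₂]; push_cast; ring⟩

/-- **Products preserve `D`-integrality**: if `D^ℓ [X^ℓ]P ∈ ℤ` and `D^ℓ [X^ℓ]Q ∈ ℤ` for all `ℓ`,
then `D^ℓ [X^ℓ](PQ) ∈ ℤ` for all `ℓ` (Cauchy product). [cite: LaiYu2020, Lemma 3.3 (proof: the sum over ℓ-tuples)] -/
theorem dInt_mul {D : ℕ} {P Q : ℚ[X]} (hP : ∀ ℓ : ℕ, ∃ z : ℤ, (D : ℚ) ^ ℓ * P.coeff ℓ = z)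
    (hQ : ∀ ℓ : ℕ, ∃ z : ℤ, (D : ℚ) ^ ℓ * Q.coeff ℓ = z) (ℓ : ℕ) :
    ∃ z : ℤ, (D : ℚ) ^ ℓ * (P * Q).coeff ℓ = z := by
  rw [coeff_mul, mul_sum]
  refine isInt_sum _ _ fun x hx => ?_
  have hx' : x.1 + x.2 = ℓ := mem_antidiagonal.1 hx
  obtain ⟨z₁, hz₁⟩ := hP x.1
  obtain ⟨z₂, hz₂⟩ := hQ x.2
  refine ⟨z₁ * z₂, ?_⟩
  rw [← hx', pow_add]
  push_cast
  rw [← hz₁, ← hz₂]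
  ring

/-- The constant polynomial `1` is `D`-integral. [folklore] -/
private theorem dInt_one (D : ℕ) (ℓ : ℕ) : ∃ z : ℤ, (D : ℚ) ^ ℓ * (1 : ℚ[X]).coeff ℓ = z := by
  rcases Nat.eq_zero_or_pos ℓ with rfl | hℓ
  · exact ⟨1, by simp⟩
  · exact ⟨0, by rw [coeff_one, if_neg (by omega)]; simp⟩

/-- Finite products preserve `D`-integrality. [cite: LaiYu2020, Lemma 3.3 (proof: the sum over ℓ-tuples)] -/
theorem dInt_prod {D : ℕ} {α : Type*} (s : Finset α) (P : α → ℚ[X])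
    (hP : ∀ a ∈ s, ∀ ℓ : ℕ, ∃ z : ℤ, (D : ℚ) ^ ℓ * (P a).coeff ℓ = z) (ℓ : ℕ) :
    ∃ z : ℤ, (D : ℚ) ^ ℓ * (∏ a ∈ s, P a).coeff ℓ = z := by
  classical
  induction s using Finset.induction_on generalizing ℓ with
  | empty => rw [prod_empty]; exact dInt_one D ℓ
  | insert a s ha ih =>
    rw [prod_insert ha]
    exact dInt_mul (hP a (mem_insert_self a s)) (fun ℓ' => ih (fun b hb => hP b (mem_insert_of_mem hb)) ℓ') ℓ

/-- Powers preserve `D`-integrality. [cite: LaiYu2020, Lemma 3.3 (proof: the sum over ℓ-tuples)] -/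
theorem dInt_pow {D : ℕ} {P : ℚ[X]} (hP : ∀ ℓ : ℕ, ∃ z : ℤ, (D : ℚ) ^ ℓ * P.coeff ℓ = z) (m ℓ : ℕ) :
    ∃ z : ℤ, (D : ℚ) ^ ℓ * (P ^ m).coeff ℓ = z := by
  have := dInt_prod (D := D) (range m) (fun _ => P) (fun _ _ => hP) ℓ
  rwa [prod_const, card_range] at this

/-- **The truncated inverse `V_c = ∑_{ℓ≤s} (−1)^ℓ X^ℓ / c^ℓ` of `1 + X/c` is `D`-integral when
`c ∣ D`** (`d_n^ℓ/(j−k)^ℓ ∈ ℤ`). [cite: LaiYu2020, Lemma 3.3 (proof: "the fact d_n^{ℓ_j}/(j−k)^{ℓ_j} ∈ ℤ")] -/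
theorem dInt_V {D : ℕ} {c : ℚ} {e : ℤ} (he : (D : ℚ) = c * e) (s ℓ : ℕ) :
    ∃ z : ℤ, (D : ℚ) ^ ℓ *
      (∑ i ∈ range (s + 1), C ((-1 : ℚ) ^ i / c ^ i) * X ^ i).coeff ℓ = z := by
  have hcoeff : (∑ i ∈ range (s + 1), C ((-1 : ℚ) ^ i / c ^ i) * X ^ i).coeff ℓ =
      if ℓ < s + 1 then (-1 : ℚ) ^ ℓ / c ^ ℓ else 0 := by
    rw [finsetSum_coeff]
    simp only [coeff_C_mul, coeff_X_pow, mul_ite, mul_one, mul_zero]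
    rw [sum_ite_eq]
    simp only [mem_range]
  rw [hcoeff]
  split_ifs with h
  · rcases eq_or_ne c 0 with rfl | hc0
    · rcases Nat.eq_zero_or_pos ℓ with rfl | hℓ
      · exact ⟨1, by simp⟩
      · exact ⟨0, by simp [zero_pow hℓ.ne']⟩
    · refine ⟨(-1) ^ ℓ * e ^ ℓ, ?_⟩
      rw [he]
      field_simp
      push_cast
      ring
  · exact ⟨0, by simp⟩

/-! ### Truncation modulo `X^{s+1}` -/

/-- `(1 + X/c) · V_c = 1 − (−X/c)^{s+1}`: `V_c` inverts `1 + X/c` modulo `X^{s+1}`. [folklore] -/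
private theorem one_add_mul_V (c : ℚ) (s : ℕ) :
    (1 + C c⁻¹ * X) * ∑ i ∈ range (s + 1), C ((-1 : ℚ) ^ i / c ^ i) * X ^ i =
      1 + X ^ (s + 1) * C (-((-c⁻¹) ^ (s + 1))) := by
  have h := mul_geom_sum (C (-c⁻¹) * X : ℚ[X]) (s + 1)
  have e1 : ∑ i ∈ range (s + 1), C ((-1 : ℚ) ^ i / c ^ i) * X ^ i =
      ∑ i ∈ range (s + 1), (C (-c⁻¹) * X) ^ i := by
    refine sum_congr rfl fun i _ => ?_
    rw [mul_pow, ← C_pow]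
    congr 2
    rw [div_eq_mul_inv, ← inv_pow, ← neg_pow]
  rw [e1]
  have e2 : (1 + C c⁻¹ * X : ℚ[X]) = -((C (-c⁻¹) * X) - 1) := by
    rw [C_neg]; ring
  rw [e2, neg_mul, h, mul_pow, ← C_pow, C_neg]
  ring

/-- A product of polynomials congruent to `1` modulo `X^{s+1}` is congruent to `1`. [folklore] -/
private theorem prod_one_add_X_pow_mul {α : Type*} (t : Finset α) (w : α → ℚ[X]) (s : ℕ) :
    ∃ W : ℚ[X], ∏ a ∈ t, (1 + X ^ (s + 1) * w a) = 1 + X ^ (s + 1) * W := by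
  classical
  induction t using Finset.induction_on with
  | empty => exact ⟨0, by simp⟩
  | insert a t ha ih =>
    obtain ⟨W, hW⟩ := ih
    refine ⟨w a + W + X ^ (s + 1) * w a * W, ?_⟩
    rw [prod_insert ha, hW]
    ring

/-- **Truncation algebra**: if `Φk = A · P + X^{s+1} E` and `P · Inv = 1 + X^{s+1} W`, then
`[X^ℓ](Φk · Inv) = [X^ℓ] A` for `ℓ ≤ s`. [cite: LaiYu2020, Lemma 3.3 (proof: "viewing t^{s+1}R_n(t−k) ∈ ℚ[[t]] as a formal series")] -/
theorem coeff_eq_of_trunc {Φk A P E Inv W : ℚ[X]} {s : ℕ} (h1 : Φk = A * P + X ^ (s + 1) * E)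
    (h2 : P * Inv = 1 + X ^ (s + 1) * W) {ℓ : ℕ} (hℓ : ℓ ≤ s) :
    (Φk * Inv).coeff ℓ = A.coeff ℓ := by
  have e : Φk * Inv = A + X ^ (s + 1) * (A * W + E * Inv) := by
    rw [h1, add_mul, mul_assoc, h2]; ring
  rw [e, coeff_add, coeff_X_pow_mul', if_neg (by omega), add_zero]

/-! ### From the partial-fraction identity to a polynomial identity at the pole `−k` -/

/-- `κ_k P_k(t) = ∏_{j≠k} (t + j − k)^{s+1}`. [folklore] -/
private theorem kappa_mul_P_eval (n s k : ℕ) (t : ℚ) :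
    (∏ j ∈ (range (n + 1)).erase k, ((j : ℚ) - k) ^ (s + 1)) *
        (∏ j ∈ (range (n + 1)).erase k, (1 + C (((j : ℚ) - k)⁻¹) * X) ^ (s + 1)).eval t =
      ∏ j ∈ (range (n + 1)).erase k, (t + ((j : ℚ) - k)) ^ (s + 1) := by
  rw [eval_prod, ← prod_mul_distrib]
  refine prod_congr rfl fun j hj => ?_
  have hjk : ((j : ℚ) - k) ≠ 0 := by
    have : j ≠ k := (mem_erase.1 hj).1
    exact sub_ne_zero.2 (by exact_mod_cast this)
  rw [eval_pow, ← mul_pow]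
  congr 1
  simp only [eval_add, eval_one, eval_mul, eval_C, eval_X]
  field_simp
  ring

/-- **The polynomial identity at the pole `−k`**: if, off the poles,
`Φ(t)/∏_{j=0}^{n}(t+j)^{s+1} = ∑_{k'=0}^{n} ∑_{i=1}^{s+1} a_{i,k'}/(t+k')^i`, then for every `k ≤ n`,
in `ℚ[X]`: `Φ(X − k) = κ_k · A_k · P_k + X^{s+1} · E_k` with `A_k = ∑_i a_{i,k} X^{s+1−i}`,
`P_k = ∏_{j≠k}(1 + X/(j−k))^{s+1}`, `κ_k = ∏_{j≠k}(j−k)^{s+1}` and the explicit polynomial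
`E_k = ∑_{k'≠k} ∑_i a_{i,k'} (X + k' − k)^{s+1−i} ∏_{j≠k,k'} (X + j − k)^{s+1}`.
[cite: LaiYu2020, Lemma 3.3 (proof: "a_{i,k} = [t^{s+1−i}](t^{s+1}R_n(t−k))")] -/
theorem eq_polynomial_identity {n s : ℕ} {Φ : ℚ[X]} {a : ℕ → ℕ → ℚ}
    (hPF : ∀ t : ℚ, (∀ j ∈ range (n + 1), t + j ≠ 0) →
      Φ.eval t / (∏ j ∈ range (n + 1), (t + j)) ^ (s + 1) =
        ∑ k' ∈ range (n + 1), ∑ i ∈ Icc 1 (s + 1), a i k' / (t + k') ^ i)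
    {k : ℕ} (hk : k ∈ range (n + 1)) :
    Φ.comp (X - C (k : ℚ)) =
      C (∏ j ∈ (range (n + 1)).erase k, ((j : ℚ) - k) ^ (s + 1)) *
          (∑ i ∈ Icc 1 (s + 1), C (a i k) * X ^ (s + 1 - i)) *
          ∏ j ∈ (range (n + 1)).erase k, (1 + C (((j : ℚ) - k)⁻¹) * X) ^ (s + 1) +
        X ^ (s + 1) * ∑ k' ∈ (range (n + 1)).erase k, ∑ i ∈ Icc 1 (s + 1),
          C (a i k') * (X + C ((k' : ℚ) - k)) ^ (s + 1 - i) *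
            ∏ j ∈ ((range (n + 1)).erase k).erase k', (X + C ((j : ℚ) - k)) ^ (s + 1) := by
  classical
  -- the set of good `t` is cofinite
  have hfin : (({0} : Set ℚ) ∪ ↑((range (n + 1)).image fun j : ℕ => (k : ℚ) - j)).Finite :=
    (Set.finite_singleton _).union (finite_toSet _)
  refine eq_of_infinite_eval_eq _ _ (hfin.infinite_compl.mono fun t ht => ?_)
  simp only [Set.mem_compl_iff, Set.mem_union, Set.mem_singleton_iff, coe_image, Set.mem_image,
    mem_coe, not_or, not_exists, not_and] at ht
  obtain ⟨ht0, htj⟩ := ht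
  have hgood : ∀ j ∈ range (n + 1), t - k + j ≠ 0 := by
    intro j hj h
    exact htj j hj (by linarith)
  have hgood' : ∀ j ∈ (range (n + 1)).erase k, t + ((j : ℚ) - k) ≠ 0 := by
    intro j hj h
    exact hgood j (mem_of_mem_erase hj) (by linarith)
  rw [Set.mem_setOf_eq]
  -- names for the evaluated blocks
  set PK : ℚ := ∏ j ∈ (range (n + 1)).erase k, (t + ((j : ℚ) - k)) ^ (s + 1) with hPK
  have hPK0 : PK ≠ 0 := prod_ne_zero_iff.2 fun j hj => pow_ne_zero _ (hgood' j hj)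
  -- `(∏_j (t - k + j))^{s+1} = t^{s+1} PK`
  have hden_eq : (∏ j ∈ range (n + 1), (t - k + j)) ^ (s + 1) = t ^ (s + 1) * PK := by
    rw [← mul_prod_erase _ _ hk, mul_pow, hPK, ← prod_pow]
    congr 1
    · ring
    · exact prod_congr rfl fun j _ => by ring
  have hden : (∏ j ∈ range (n + 1), (t - k + j)) ^ (s + 1) ≠ 0 := by
    rw [hden_eq]; exact mul_ne_zero (pow_ne_zero _ ht0) hPK0
  -- left-hand side
  have hL : (Φ.comp (X - C (k : ℚ))).eval t = Φ.eval (t - k) := by simp [eval_comp]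
  have h1 := hPF (t - k) hgood
  rw [div_eq_iff hden] at h1
  rw [hL, h1, sum_mul, ← add_sum_erase _ _ hk, hden_eq]
  -- right-hand side, evaluated
  simp only [eval_add, eval_mul, eval_C, eval_finsetSum, eval_pow, eval_X]
  have hκP := kappa_mul_P_eval n s k t
  rw [← hPK] at hκP
  rw [mul_assoc (∏ j ∈ (range (n + 1)).erase k, ((j : ℚ) - k) ^ (s + 1)),
    mul_left_comm (∏ j ∈ (range (n + 1)).erase k, ((j : ℚ) - k) ^ (s + 1)), hκP]
  congr 1
  · -- the `k' = k` block: `(∑_i a_{i,k}/t^i) · t^{s+1} PK = A_k(t) · PK`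
    rw [sum_mul, sum_mul]
    refine sum_congr rfl fun i hi => ?_
    rw [mem_Icc] at hi
    rw [show (t : ℚ) - k + k = t by ring, pow_sub₀ t ht0 hi.2]
    field_simp
  · -- the `k' ≠ k` blocks
    rw [mul_sum]
    refine sum_congr rfl fun k' hk' => ?_
    rw [sum_mul, mul_sum]
    refine sum_congr rfl fun i hi => ?_
    rw [mem_Icc] at hi
    have hk'0 : t + ((k' : ℚ) - k) ≠ 0 := hgood' k' hk'
    have hPsplit : PK = (t + ((k' : ℚ) - k)) ^ (s + 1) *
        ∏ j ∈ ((range (n + 1)).erase k).erase k', (t + ((j : ℚ) - k)) ^ (s + 1) := by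
      rw [hPK, mul_prod_erase ((range (n + 1)).erase k) (fun j => (t + ((j : ℚ) - k)) ^ (s + 1)) hk']
    simp only [eval_prod, eval_pow, eval_add, eval_X, eval_C]
    rw [hPsplit, show (t : ℚ) - k + k' = t + ((k' : ℚ) - k) by ring, pow_sub₀ _ hk'0 hi.2]
    field_simp

/-! ### The coefficient formula and the arithmetic lemma -/

/-- `P_k · Inv_k ≡ 1 (mod X^{s+1})` for `Inv_k = ∏_{j≠k} V_{j−k}^{s+1}` (the truncation of
`∏_{j≠k}(1 + t/(j−k))^{−s−1}`). [cite: LaiYu2020, Lemma 3.3 (proof: "∏_{j≠k}(1 + t/(j−k))^{−s−1}" as a formal series)] -/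
theorem exists_P_mul_Inv (n s k : ℕ) : ∃ W : ℚ[X],
    (∏ j ∈ (range (n + 1)).erase k, (1 + C (((j : ℚ) - k)⁻¹) * X) ^ (s + 1)) *
        ∏ j ∈ (range (n + 1)).erase k,
          (∑ i ∈ range (s + 1), C ((-1 : ℚ) ^ i / ((j : ℚ) - k) ^ i) * X ^ i) ^ (s + 1) =
      1 + X ^ (s + 1) * W := by
  rw [← prod_mul_distrib]
  have h : ∀ j ∈ (range (n + 1)).erase k,
      (1 + C (((j : ℚ) - k)⁻¹) * X) ^ (s + 1) *
          (∑ i ∈ range (s + 1), C ((-1 : ℚ) ^ i / ((j : ℚ) - k) ^ i) * X ^ i) ^ (s + 1) =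
        ∏ _m ∈ range (s + 1), (1 + X ^ (s + 1) * C (-((-((j : ℚ) - k)⁻¹) ^ (s + 1)))) := by
    intro j _
    rw [← mul_pow, one_add_mul_V, prod_const, card_range]
  rw [prod_congr rfl h, ← prod_product']
  exact prod_one_add_X_pow_mul (((range (n + 1)).erase k) ×ˢ range (s + 1))
    (fun p => C (-((-((p.1 : ℚ) - k)⁻¹) ^ (s + 1)))) s

/-- The coefficients of `A_k = ∑_{i=1}^{s+1} a_{i,k} X^{s+1−i}`: `[X^ℓ] A_k = a_{s+1−ℓ,k}` (`ℓ ≤ s`).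
[folklore] -/
private theorem coeff_A (a : ℕ → ℕ → ℚ) (s k : ℕ) {ℓ : ℕ} (hℓ : ℓ ≤ s) :
    (∑ i ∈ Icc 1 (s + 1), C (a i k) * X ^ (s + 1 - i)).coeff ℓ = a (s + 1 - ℓ) k := by
  rw [finsetSum_coeff]
  simp only [coeff_C_mul, coeff_X_pow, mul_ite, mul_one, mul_zero]
  rw [sum_eq_single (s + 1 - ℓ)]
  · rw [if_pos (by omega)]
  · intro i hi hne
    rw [mem_Icc] at hi
    rw [if_neg (by omega)]
  · intro h
    exfalso
    exact h (mem_Icc.2 ⟨by omega, by omega⟩)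

/-- **The coefficient formula** `κ_k a_{i,k} = [X^{s+1−i}] (Φ(X−k) · Inv_k(X))` (`1 ≤ i ≤ s+1`),
`Inv_k = ∏_{j≠k} (∑_{m≤s} (−X/(j−k))^m)^{s+1}` — the polynomial form of
`a_{i,k} = [t^{s+1−i}](t^{s+1}R_n(t−k)) = C(n,k)^{s+1}[t^{s+1−i}](Φ₀(t−k) ∏_{j≠k}(1 + t/(j−k))^{−s−1})`.
[cite: LaiYu2020, Lemma 3.3 (proof, displayed computation of a_{i,k})] -/
theorem partialFraction_coeff_eq {n s : ℕ} {Φ : ℚ[X]} {a : ℕ → ℕ → ℚ}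
    (hPF : ∀ t : ℚ, (∀ j ∈ range (n + 1), t + j ≠ 0) →
      Φ.eval t / (∏ j ∈ range (n + 1), (t + j)) ^ (s + 1) =
        ∑ k' ∈ range (n + 1), ∑ i ∈ Icc 1 (s + 1), a i k' / (t + k') ^ i)
    {k : ℕ} (hk : k ∈ range (n + 1)) {i : ℕ} (hi : i ∈ Icc 1 (s + 1)) :
    (∏ j ∈ (range (n + 1)).erase k, ((j : ℚ) - k) ^ (s + 1)) * a i k =
      (Φ.comp (X - C (k : ℚ)) * ∏ j ∈ (range (n + 1)).erase k,
        (∑ m ∈ range (s + 1), C ((-1 : ℚ) ^ m / ((j : ℚ) - k) ^ m) * X ^ m) ^ (s + 1)).coeff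
        (s + 1 - i) := by
  rw [mem_Icc] at hi
  obtain ⟨W, hW⟩ := exists_P_mul_Inv n s k
  have h1 := eq_polynomial_identity hPF hk
  rw [coeff_eq_of_trunc h1 hW (by omega : s + 1 - i ≤ s), coeff_C_mul,
    coeff_A a s k (by omega : s + 1 - i ≤ s)]
  congr 2
  omega

/-- `∏_{j ≤ n, j ≠ k} (j − k) = (−1)^k k! (n−k)!`. [folklore] -/
private theorem prod_erase_sub (n k : ℕ) (hk : k ≤ n) :
    ∏ j ∈ (range (n + 1)).erase k, ((j : ℚ) - k) =
      (-1) ^ k * (k.factorial : ℚ) * ((n - k).factorial : ℚ) := by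
  have hsplit : (range (n + 1)).erase k = range k ∪ Ico (k + 1) (n + 1) := by
    ext j
    simp only [mem_erase, mem_range, mem_union, mem_Ico]
    omega
  have hdisj : Disjoint (range k) (Ico (k + 1) (n + 1)) := by
    rw [disjoint_left]
    intro j hj hj'
    rw [mem_range] at hj
    rw [mem_Ico] at hj'
    omega
  rw [hsplit, prod_union hdisj]
  -- `∏_{j<k} (j - k) = (-1)^k k!`
  have h1 : ∏ j ∈ range k, ((j : ℚ) - k) = (-1) ^ k * (k.factorial : ℚ) := by
    rw [← prod_range_add_one_eq_factorial, Nat.cast_prod, ← prod_range_reflect, pow_eq_prod_const,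
      ← prod_mul_distrib]
    refine prod_congr rfl fun j hj => ?_
    rw [mem_range] at hj
    push_cast [Nat.cast_sub (by omega : j ≤ k - 1), Nat.cast_sub (by omega : 1 ≤ k)]
    ring
  -- `∏_{j=k+1}^{n} (j - k) = (n-k)!`
  have h2 : ∏ j ∈ Ico (k + 1) (n + 1), ((j : ℚ) - k) = ((n - k).factorial : ℚ) := by
    rw [← prod_range_add_one_eq_factorial, Nat.cast_prod, prod_Ico_eq_prod_range,
      show n + 1 - (k + 1) = n - k by omega]
    refine prod_congr rfl fun j _ => ?_
    push_cast
    ring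
  rw [h1, h2]

/-- `n!^{s+1}/κ_k = ((−1)^k C(n,k))^{s+1}`. [folklore] -/
private theorem factorial_pow_div_kappa (n s k : ℕ) (hk : k ≤ n) :
    ((n.factorial : ℚ)) ^ (s + 1) / ∏ j ∈ (range (n + 1)).erase k, ((j : ℚ) - k) ^ (s + 1) =
      ((-1) ^ k * (n.choose k : ℚ)) ^ (s + 1) := by
  rw [prod_pow, prod_erase_sub n k hk, ← div_pow]
  congr 1
  have hk0 : (k.factorial : ℚ) ≠ 0 := by positivity
  have hnk0 : ((n - k).factorial : ℚ) ≠ 0 := by positivity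
  rw [Nat.cast_choose ℚ hk]
  field_simp
  rw [← pow_mul, mul_comm, pow_mul, neg_one_sq, one_pow]

/-- **Lai–Yu 2020, Lemma 3.3, first half** (PROVED, general form): let
`Φ = n!^{s+1} Φ₀` with `D^ℓ [X^ℓ] Φ₀(X−k) ∈ ℤ` for all `ℓ` (Lai–Yu: `Φ₀ = ∏ F̃_{b,a}`,
Proposition 3.2), let `D` be a common multiple of `1, …, n` (`D = d_n`), and let `a_{i,k'}` be
partial-fraction coefficients: `Φ(t)/∏_{j=0}^{n}(t+j)^{s+1} = ∑_{k'} ∑_{i=1}^{s+1} a_{i,k'}/(t+k')^i`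
off the poles. Then **`D^{s+1−i} a_{i,k} ∈ ℤ`** for `1 ≤ i ≤ s+1`, `k ≤ n`.
[cite: LaiYu2020, Lemma 3.3 (d_n^{s+1−i} a_{i,k} ∈ ℤ)] -/
theorem partialFraction_coeff_isInt {n s D : ℕ} {Φ₀ : ℚ[X]} {a : ℕ → ℕ → ℚ}
    (hPF : ∀ t : ℚ, (∀ j ∈ range (n + 1), t + j ≠ 0) →
      (C ((n.factorial : ℚ) ^ (s + 1)) * Φ₀).eval t / (∏ j ∈ range (n + 1), (t + j)) ^ (s + 1) =
        ∑ k' ∈ range (n + 1), ∑ i ∈ Icc 1 (s + 1), a i k' / (t + k') ^ i)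
    (hD : ∀ j : ℕ, 1 ≤ j → j ≤ n → (j : ℤ) ∣ D)
    {k : ℕ} (hk : k ∈ range (n + 1))
    (hΦ₀ : ∀ ℓ : ℕ, ∃ z : ℤ, (D : ℚ) ^ ℓ * (Φ₀.comp (X - C (k : ℚ))).coeff ℓ = z)
    {i : ℕ} (hi : i ∈ Icc 1 (s + 1)) :
    ∃ z : ℤ, (D : ℚ) ^ (s + 1 - i) * a i k = z := by
  have hkn : k ≤ n := by have := mem_range.1 hk; omega
  have h1 := partialFraction_coeff_eq hPF hk hi
  set Inv : ℚ[X] := ∏ j ∈ (range (n + 1)).erase k,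
    (∑ m ∈ range (s + 1), C ((-1 : ℚ) ^ m / ((j : ℚ) - k) ^ m) * X ^ m) ^ (s + 1) with hInv
  -- `D`-integrality of `Φ₀(X-k) · Inv`
  have hInt : ∀ ℓ : ℕ, ∃ z : ℤ, (D : ℚ) ^ ℓ * (Φ₀.comp (X - C (k : ℚ)) * Inv).coeff ℓ = z := by
    refine dInt_mul hΦ₀ fun ℓ => ?_
    refine dInt_prod _ _ (fun j hj ℓ' => dInt_pow (fun ℓ'' => ?_) _ _) ℓ
    -- `j - k ∣ D`
    have hjk : j ≠ k := (mem_erase.1 hj).1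
    have hjn : j ≤ n := by have := mem_range.1 (mem_of_mem_erase hj); omega
    have hdvd : ((j : ℤ) - k) ∣ (D : ℤ) := by
      rw [← Int.natAbs_dvd]
      refine hD _ ?_ ?_
      · have : ((j : ℤ) - k) ≠ 0 := sub_ne_zero.2 (by exact_mod_cast hjk)
        have := Int.natAbs_pos.2 this
        omega
      · have : ((j : ℤ) - k).natAbs ≤ n := by omega
        exact this
    obtain ⟨e, he⟩ := hdvd
    exact dInt_V (c := (j : ℚ) - k) (e := e) (by exact_mod_cast he) s ℓ''
  obtain ⟨q, hq⟩ := hInt (s + 1 - i)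
  -- `κ a = n!^{s+1} · coeff`, and `n!^{s+1}/κ = (± C(n,k))^{s+1}`
  have hκ0 : (∏ j ∈ (range (n + 1)).erase k, ((j : ℚ) - k) ^ (s + 1)) ≠ 0 :=
    prod_ne_zero_iff.2 fun j hj => pow_ne_zero _
      (sub_ne_zero.2 (by exact_mod_cast (mem_erase.1 hj).1))
  have h2 : (C ((n.factorial : ℚ) ^ (s + 1)) * Φ₀).comp (X - C (k : ℚ)) * Inv =
      C ((n.factorial : ℚ) ^ (s + 1)) * (Φ₀.comp (X - C (k : ℚ)) * Inv) := by
    rw [mul_comp, C_comp, mul_assoc]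
  rw [h2, coeff_C_mul] at h1
  have h3 : a i k = ((-1) ^ k * (n.choose k : ℚ)) ^ (s + 1) *
      (Φ₀.comp (X - C (k : ℚ)) * Inv).coeff (s + 1 - i) := by
    rw [← factorial_pow_div_kappa n s k hkn]
    field_simp
    linarith [h1]
  refine ⟨((-1) ^ k * (n.choose k : ℤ)) ^ (s + 1) * q, ?_⟩
  rw [h3, mul_left_comm, hq]
  push_cast
  ring

end Literature.NumberTheory.Irrationality.LaiYu2020

end
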